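import Summits.BirchSwinnertonDyer.Rank1Residual.Additive.QuadraticBranchOddStrictExactControlDischarge
import Summits.BirchSwinnertonDyer.Rank1Residual.Additive.StrictSelmerIndex
import HarnessLib

/-!
# END-TO-END ON THE ODD `η`-BRANCH: (C1_η) ∧ (C2_η-GZ) ⟹ `BSD(W, p)` in analytic rank one, the
# Selmer-side input (C3_η) being a THEOREM given `hPT` + the Kitajima–Otsuki reading + the exact
# Kobayashi-7.4 reading + GZK (file 123) and the index input being gen 30's theorem
# (cell `b2b-bsdres`, CLASS-CLOSURE lane, class O10 — x1b GEN 44, class lead; file 124 of the series)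

HONEST FRAMING (cell `b2b-bsdres`, run/shared/lean/b2b/bsd-rank1-residual/, verbatim in every
file): the goal of the cell is to DELETE the COMBINATION-SHAPED residual classes of the
Birch–Swinnerton-Dyer formula for ALL analytic-rank `≤ 1` elliptic curves over `ℚ` — "full BSD
formula for every rank `≤ 1` curve in class `C`" assembled STRICTLY from published theorems — so
that the rank-`≤ 1` remainder becomes exactly the CONSTRUCTION-SHAPED classes, which are TYPED
(missing-input `Prop`s), NOT attempted. This is not "finishing BSD". CLASS-CLOSURE lane: prove
what is provable now; shrink each hard class to its core with data; no claim beyond stated classes;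
research routes on CONSTRUCTION-SHAPED X12 / O10; census / instrument output = EVIDENCE / conjecture
items, NEVER a Literature fact; `RESIDUAL-MAP.md` marks change only by signed lines. THIS FILE:
TOOL THEOREMS ONLY — no definition, no named Literature fact, no Summits-side fact `def … : Prop`,
no `sorry`, axioms standard. EVERY theorem is CONDITIONAL on its displayed hypotheses: the typed
CONJECTURES (C1_η) `QuadraticBranchPlusMainConjectureAt V p` (Kobayashi's even main conjecture at `η`
— conjecture in print; for CM `V` Pollack–Rubin's REMARK) and (C2_η-GZ)
`QuadraticBranchMinusLeadingValuationAt W p 0` (= `QuadraticBranchPAdicGrossZagierValuationAt W p`,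
OUR conjecture, EVIDENCE item, in no source); the NAMED FACTS `hmod` (modularity / entire `L`), `hGZ`
(Gross–Zagier I.(7.3)), `hGZK` (Gross–Zagier–Kolyvagin), `hPT` (Poitou–Tate for finite Selmer
structures); and the READINGS `hR2` (typed reading of Kitajima–Otsuki 2018 Main Thm. 1.3, sign `−`;
or its verbatim shape `hKO`) and `h74x` (EXACT reading of Kobayashi 2003 Thm. 7.4 at `η`: (C1_η) ⟹
`Char X^{−,str}(W/ℚ_∞) = (X⁻¹L_p⁻(V, η, X))`; hypothesis text, nothing asserted). Nothing is booked;
no label / mark / count / sub-cell moves; O10-PS / O7-ss ∩ `e = 2` / O5a stay OPEN; nothing about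
`BSD(W, p)` of any particular pair is claimed.

## What

cc-typer-6's PROVED consumer `bsdp_of_quadraticBranchPAdicGrossZagierValuation_of_exactControl_index`
(p307042 §4 with gen 30's index, `StrictSelmerIndex.lean` §5) takes the three typed inputs (C1_η),
(C2_η-GZ), (C3_η). File 123 (`quadraticBranchOddStrictExactControlOfPlusMCAt_of_readings`) makes
(C3_η) a consequence of `hPT` + `hR2` + `h74x` + `hGZK`. Composing:

* `bsdp_of_plusMC_of_pAdicGrossZagierValuation_of_readings` — **(C1_η) ∧ (C2_η-GZ) ⟹ `BSDp W p`** at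
  a pair `(W, p)` of analytic rank one carrying the data (`p ≥ 5`, the good `a_p = 0` twin `V`,
  newform, period ratio, an `L` with the interpolation property of `L_p⁻(V, η, X)`, `W(ℚ_p)` with no
  point of order `p`, a generator of level `n`), GIVEN `hmod`, `hGZ`, `hGZK`, `hPT`, `hR2`, `h74x`;
* `…_of_kitajimaOtsuki` — the same with `hR2` replaced by the verbatim shape `hKO`;
* `pPart_of_plusMC_of_pAdicGrossZagierValuation_of_readings` — hence `PPart W p ∧ MissingPPartAt W p`.

So on the O10-PS node of record (`X12.O10.LowerHalfOnType` ⟸ (C1_η) ∧ (C2_η), p255460) the kernel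
now carries the implication with NO further typed missing input: the residue of the class is EXACTLY
(C1_η) ∧ (C2_η-GZ) plus named facts and two readings of printed theorems. NOTHING about either
conjecture is claimed.

References: [Kobayashi2003] §4 (p. 8), Thm. 7.4 (p. 13), Thm. 9.3 (p. 26); [KitajimaOtsuki2018] Main
Thm. 1.3; [GrossZagier1986] Thm. I.(7.3); [Gross1991] Thm. 1.3; [MilneADT2006] I Thm. 4.10;
[Miller2011LMS] §1, Def. 1.1; [Darmon2004] Thm. 3.22.
-/

noncomputable section

open scoped Classical MatrixGroups ModularForm

open CongruenceSubgroup Field Function NumberField IsDedekindDomain WeierstrassCurve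
open Literature.NumberTheory.EllipticCurves
open Literature.NumberTheory.EllipticCurves.ModularForms
open Literature.NumberTheory.EllipticCurves.Kobayashi2003
open Literature.NumberTheory.EllipticCurves.Rank1Residual
open Literature.NumberTheory.EllipticCurves.Rank1Residual.Typed
open Literature.NumberTheory.GaloisRepresentations
open Literature.NumberTheory.GaloisCohomology

-- Over `ℚ` two `ℚ`-algebra structures on a completion are in scope; the general-`K` statements must be
-- met by the completion's own (the device of files 78, 107, 108, 118, 120–123).
attribute [local instance 10000] IsDedekindDomain.HeightOneSpectrum.instAlgebraAdicCompletion
  NumberField.Place.instAlgebraCompletion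

namespace Summit.BirchSwinnertonDyer.Rank1Residual.Additive.LevelBridge

variable (W : WeierstrassCurve ℚ) [W.IsElliptic] [W.IsGloballyMinimal] (p : ℕ) [hp : Fact p.Prime]
  {V : WeierstrassCurve ℚ} [V.IsElliptic] [V.IsGloballyMinimal] {C : VariableChange ℚ}
  {N : ℕ} [NeZero N] {f : CuspForm (Gamma0 N) 2} {ϖ : ℚ} {L : IwasawaAlgebra p}
  {P : W.toAffine.Point} {n : ℕ}

/-- **(C1_η) ∧ (C2_η-GZ) ⟹ `BSD(W, p)` in analytic rank one, given `hmod`, `hGZ`, `hGZK`, `hPT`, the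
Kitajima–Otsuki reading (R2) and the exact Kobayashi-7.4 reading** — cc-typer-6's consumer with the
index discharged (gen 30) and its (C3_η) input supplied by file 123. CONDITIONAL on every displayed
hypothesis; (C1_η) and (C2_η-GZ) are CONJECTURES (typed), NOT claimed; nothing booked; the classes
served stay OPEN. [cite: Miller2011LMS, §1 and Def. 1.1] [cite: Kobayashi2003, §4 (p. 8), Thm. 7.4 (p. 13), Thm. 9.3 (p. 26)]
[cite: GrossZagier1986, Thm. I.(7.3) 2) (p. 231)] [cite: KitajimaOtsuki2018, Main Thm. 1.3 (arXiv:1607.03612 p. 3)] -/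
theorem bsdp_of_plusMC_of_pAdicGrossZagierValuation_of_readings
    (hmod : hasEntireLFunction_rat) (hGZ : GrossZagier1986_thm_I_7_3)
    (hGZK : rank_eq_analyticRank_of_analyticRank_le_one)
    (hPT : poitouTate_selmerStructure_duality_real ℚ)
    (hR2 : OddBranchStrictMinusNoFiniteSubmoduleAt W p)
    (h74x : ∀ (V : WeierstrassCurve ℚ) [V.IsElliptic] [V.IsGloballyMinimal] (C : VariableChange ℚ)
        {N : ℕ} [NeZero N] {f : CuspForm (Gamma0 N) 2},
        p ≠ 2 → C • W.quadraticTwist ((-1) ^ (p / 2) * p) = V →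
        V.HasGoodReductionAtPrime p → V.frobeniusTrace p = 0 →
        QuadraticBranchPlusMainConjectureAt V p → IsNewformOf V f →
        ∀ (ϖ : ℚ), (if Even (p / 2) then (ϖ : ℝ) * V.realPeriodRat = plusPeriod f
            else (ϖ : ℝ) * V.imaginaryPeriodRat = minusPeriod f) →
        ∀ (Lη : IwasawaAlgebra p), IsQuadraticBranchMinusLFunction f p ϖ Lη →
        ∀ (κ : ZpExtension ℚ p) (γ : Field.absoluteGaloisGroup ℚ),
          κ.IsCyclotomic → κ.IsTopGenerator γ → IsCyclotomicVariable p γ →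
        ∀ (D : StrictSignedSelmerDualData W κ ℚ_[p] γ (-1)) (L' : IwasawaAlgebra p),
          Lη = PowerSeries.X * L' → D.charIdeal = Ideal.span {L'})
    (h2 : QuadraticBranchMinusLeadingValuationAt W p 0)
    (hp5 : 5 ≤ p) (hC : C • W.quadraticTwist ((-1) ^ (p / 2) * p) = V)
    (hgood : V.HasGoodReductionAtPrime p) (hap : V.frobeniusTrace p = 0)
    (h1 : QuadraticBranchPlusMainConjectureAt V p) (hf : IsNewformOf V f)
    (hϖ : if Even (p / 2) then (ϖ : ℝ) * V.realPeriodRat = plusPeriod f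
        else (ϖ : ℝ) * V.imaginaryPeriodRat = minusPeriod f)
    (hL : IsQuadraticBranchMinusLFunction f p ϖ L)
    (htors : ∀ Q : (W.baseChange ℚ_[p]).toAffine.Point, p • Q = 0 → Q = 0)
    (hP : ¬ IsOfFinAddOrder P)
    (hgen : ∀ R : W.toAffine.Point, ∃ (k : ℤ) (T : W.toAffine.Point),
      IsOfFinAddOrder T ∧ R = k • P + T)
    (hdiv : ∃ Q : (W.baseChange ℚ_[p]).toAffine.Point, p ^ n • Q = W.toPadicPoint p P)
    (hndiv : ∀ Q : (W.baseChange ℚ_[p]).toAffine.Point, p ^ (n + 1) • Q ≠ W.toPadicPoint p P)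
    (hr : W.analyticRank = 1) : BSDp W p :=
  bsdp_of_quadraticBranchPAdicGrossZagierValuation_of_exactControl_index W p hmod hGZ hGZK h2
    (quadraticBranchOddStrictExactControlOfPlusMCAt_of_readings W p hPT hGZK hR2 h74x) hp5 hC hgood hap h1
    hf hϖ hL htors hP hgen hdiv hndiv hr

/-- **The same with the Kitajima–Otsuki input in its VERBATIM SHAPE `hKO`** (cc-typer-6's text `HKO p`;
dictionary theorem P5-5b). CONDITIONAL on every displayed hypothesis; (C1_η), (C2_η-GZ) NOT claimed;
nothing booked. [cite: KitajimaOtsuki2018, Main Thm. 1.3 (= Thm. 4.8) with Def. 2.1 (arXiv:1607.03612 pp. 3, 6)]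
[cite: Miller2011LMS, §1 and Def. 1.1] -/
theorem bsdp_of_plusMC_of_pAdicGrossZagierValuation_of_kitajimaOtsuki
    (hmod : hasEntireLFunction_rat) (hGZ : GrossZagier1986_thm_I_7_3)
    (hGZK : rank_eq_analyticRank_of_analyticRank_le_one)
    (hPT : poitouTate_selmerStructure_duality_real ℚ)
    (hKO : ∀ (K₀ : Type) [Field K₀] [NumberField K₀] [IsCyclotomicExtension {p} ℚ K₀]
        [(galRange (K := ℚ) K₀).Normal] (ηq : absoluteGaloisGroup ℚ →* ℤˣ),
        (∀ σ ∈ galRange (K := ℚ) K₀, ηq σ = 1) →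
      ∀ (V : WeierstrassCurve ℚ) [V.IsElliptic] [V.IsGloballyMinimal],
        p ≠ 2 → V.HasGoodReductionAtPrime p → V.frobeniusTrace p = 0 →
      ∀ (κ : ZpExtension ℚ p) (γ : absoluteGaloisGroup ℚ),
        κ.IsCyclotomic → κ.IsTopGenerator γ → γ ∈ galRange (K := ℚ) K₀ →
      ∀ (D : EtaSignedSelmerDualData V κ K₀ ℚ_[p] ηq γ (-1)),
        Module.Finite (IwasawaAlgebra p) D.X → Module.IsTorsion (IwasawaAlgebra p) D.X →
        ∀ M : Submodule (IwasawaAlgebra p) D.X, Finite M → M = ⊥)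
    (h74x : ∀ (V : WeierstrassCurve ℚ) [V.IsElliptic] [V.IsGloballyMinimal] (C : VariableChange ℚ)
        {N : ℕ} [NeZero N] {f : CuspForm (Gamma0 N) 2},
        p ≠ 2 → C • W.quadraticTwist ((-1) ^ (p / 2) * p) = V →
        V.HasGoodReductionAtPrime p → V.frobeniusTrace p = 0 →
        QuadraticBranchPlusMainConjectureAt V p → IsNewformOf V f →
        ∀ (ϖ : ℚ), (if Even (p / 2) then (ϖ : ℝ) * V.realPeriodRat = plusPeriod f
            else (ϖ : ℝ) * V.imaginaryPeriodRat = minusPeriod f) →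
        ∀ (Lη : IwasawaAlgebra p), IsQuadraticBranchMinusLFunction f p ϖ Lη →
        ∀ (κ : ZpExtension ℚ p) (γ : Field.absoluteGaloisGroup ℚ),
          κ.IsCyclotomic → κ.IsTopGenerator γ → IsCyclotomicVariable p γ →
        ∀ (D : StrictSignedSelmerDualData W κ ℚ_[p] γ (-1)) (L' : IwasawaAlgebra p),
          Lη = PowerSeries.X * L' → D.charIdeal = Ideal.span {L'})
    (h2 : QuadraticBranchMinusLeadingValuationAt W p 0)
    (hp5 : 5 ≤ p) (hC : C • W.quadraticTwist ((-1) ^ (p / 2) * p) = V)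
    (hgood : V.HasGoodReductionAtPrime p) (hap : V.frobeniusTrace p = 0)
    (h1 : QuadraticBranchPlusMainConjectureAt V p) (hf : IsNewformOf V f)
    (hϖ : if Even (p / 2) then (ϖ : ℝ) * V.realPeriodRat = plusPeriod f
        else (ϖ : ℝ) * V.imaginaryPeriodRat = minusPeriod f)
    (hL : IsQuadraticBranchMinusLFunction f p ϖ L)
    (htors : ∀ Q : (W.baseChange ℚ_[p]).toAffine.Point, p • Q = 0 → Q = 0)
    (hP : ¬ IsOfFinAddOrder P)
    (hgen : ∀ R : W.toAffine.Point, ∃ (k : ℤ) (T : W.toAffine.Point),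
      IsOfFinAddOrder T ∧ R = k • P + T)
    (hdiv : ∃ Q : (W.baseChange ℚ_[p]).toAffine.Point, p ^ n • Q = W.toPadicPoint p P)
    (hndiv : ∀ Q : (W.baseChange ℚ_[p]).toAffine.Point, p ^ (n + 1) • Q ≠ W.toPadicPoint p P)
    (hr : W.analyticRank = 1) : BSDp W p :=
  bsdp_of_plusMC_of_pAdicGrossZagierValuation_of_readings W p hmod hGZ hGZK hPT
    (SignedTwist.oddBranchStrictMinusNoFiniteSubmoduleAt_of_kitajimaOtsuki13MinusEta W p hKO) h74x h2 hp5 hC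
    hgood hap h1 hf hϖ hL htors hP hgen hdiv hndiv hr

/-- … hence the cell's print shape **`PPart W p`** and the typed output **`MissingPPartAt W p`**, from
(C1_η) ∧ (C2_η-GZ) + named facts + readings. CONDITIONAL on every displayed hypothesis; (C1_η),
(C2_η-GZ) NOT claimed; nothing booked. [cite: Miller2011LMS, §1 and Def. 1.1] [cite: YanZhu2026, Thm. 4.15 (display; shape only)] -/
theorem pPart_of_plusMC_of_pAdicGrossZagierValuation_of_readings
    (hmod : hasEntireLFunction_rat) (hGZ : GrossZagier1986_thm_I_7_3)
    (hGZK : rank_eq_analyticRank_of_analyticRank_le_one)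
    (hPT : poitouTate_selmerStructure_duality_real ℚ)
    (hR2 : OddBranchStrictMinusNoFiniteSubmoduleAt W p)
    (h74x : ∀ (V : WeierstrassCurve ℚ) [V.IsElliptic] [V.IsGloballyMinimal] (C : VariableChange ℚ)
        {N : ℕ} [NeZero N] {f : CuspForm (Gamma0 N) 2},
        p ≠ 2 → C • W.quadraticTwist ((-1) ^ (p / 2) * p) = V →
        V.HasGoodReductionAtPrime p → V.frobeniusTrace p = 0 →
        QuadraticBranchPlusMainConjectureAt V p → IsNewformOf V f →
        ∀ (ϖ : ℚ), (if Even (p / 2) then (ϖ : ℝ) * V.realPeriodRat = plusPeriod f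
            else (ϖ : ℝ) * V.imaginaryPeriodRat = minusPeriod f) →
        ∀ (Lη : IwasawaAlgebra p), IsQuadraticBranchMinusLFunction f p ϖ Lη →
        ∀ (κ : ZpExtension ℚ p) (γ : Field.absoluteGaloisGroup ℚ),
          κ.IsCyclotomic → κ.IsTopGenerator γ → IsCyclotomicVariable p γ →
        ∀ (D : StrictSignedSelmerDualData W κ ℚ_[p] γ (-1)) (L' : IwasawaAlgebra p),
          Lη = PowerSeries.X * L' → D.charIdeal = Ideal.span {L'})
    (h2 : QuadraticBranchMinusLeadingValuationAt W p 0)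
    (hp5 : 5 ≤ p) (hC : C • W.quadraticTwist ((-1) ^ (p / 2) * p) = V)
    (hgood : V.HasGoodReductionAtPrime p) (hap : V.frobeniusTrace p = 0)
    (h1 : QuadraticBranchPlusMainConjectureAt V p) (hf : IsNewformOf V f)
    (hϖ : if Even (p / 2) then (ϖ : ℝ) * V.realPeriodRat = plusPeriod f
        else (ϖ : ℝ) * V.imaginaryPeriodRat = minusPeriod f)
    (hL : IsQuadraticBranchMinusLFunction f p ϖ L)
    (htors : ∀ Q : (W.baseChange ℚ_[p]).toAffine.Point, p • Q = 0 → Q = 0)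
    (hP : ¬ IsOfFinAddOrder P)
    (hgen : ∀ R : W.toAffine.Point, ∃ (k : ℤ) (T : W.toAffine.Point),
      IsOfFinAddOrder T ∧ R = k • P + T)
    (hdiv : ∃ Q : (W.baseChange ℚ_[p]).toAffine.Point, p ^ n • Q = W.toPadicPoint p P)
    (hndiv : ∀ Q : (W.baseChange ℚ_[p]).toAffine.Point, p ^ (n + 1) • Q ≠ W.toPadicPoint p P)
    (hr : W.analyticRank = 1) : Rank1Residual.PPart W p ∧ MissingPPartAt W p :=
  pPart_of_quadraticBranchPAdicGrossZagierValuation_of_exactControl_index W p hmod hGZ hGZK h2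
    (quadraticBranchOddStrictExactControlOfPlusMCAt_of_readings W p hPT hGZK hR2 h74x) hp5 hC hgood hap h1
    hf hϖ hL htors hP hgen hdiv hndiv hr

end Summit.BirchSwinnertonDyer.Rank1Residual.Additive.LevelBridge

end
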